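import Literature.NumberTheory.Rogawski1990.ArchCentralizerHaarMeasures   -- ★ `OrbitalMeasureFamily.exists_isQuotientOf` (+ ★ `isMulRightInvariant_of_forall_comm`, `isInvInvariant_of_isMulRightInvariant_of_isClosed`)
import HarnessLib

/-!
# Torus-normalised centraliser measures: ONE Haar measure on a torus `T` transported to every centraliser `Z(γ) = T`, and the resulting Weil-form
# orbital-measure family (road D1′ ∕ «D2′a», the measure half of (V2); Rogawski 1990 §1.7, §4.3; Harish-Chandra's `F_f`)

Topic `NumberTheory/Automorphic`; namespace `Literature.NumberTheory.Automorphic`.  THEOREMS ONLY (no definition, no named fact, no instance, no notation, no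
`sorry`).  Cell `hodgecm-mathlib`, floor-1 prep under #88 (ST-∞) ∕ #111 (S-d) (CENSUS-D2prime-HClimit §4 (V2), LEAD T6-84∕T6-87): Harish-Chandra's normalised orbital
integral `γ ↦ D(γ)^{1∕2} Φ_γ(f)` along a Cartan subgroup `T` is a FUNCTION of `γ ∈ T_reg` only when the orbit measures at all regular `γ ∈ T` are normalised by ONE
Haar measure `t_T` of `T` — print's standing convention ([Rogawski1990] §1.7 p. 6 «all measures on groups are assumed to be Haar measures», §4.3 (4.3.1) p. 43
«compatible measures on `H_{γ_H}` and `G_γ`»).  In the tree's currency the orbit measures are indexed by centraliser measures `t γ` on `Z(γ)` (★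
`OrbitalMeasureFamily.IsQuotientOf P ν t m`, Weil form `m c = dν ∕ dt_{γ_c}`); this file builds, from ONE Haar measure `t_T` on a subgroup `T` and a predicate `P` of
elements whose centraliser IS `T` (★ `ArchLocalRegularCentralizer.centralizer_circleDiagonal_eq_subgroupOf` supplies this on `T_reg` for the circle torus of
`U(σ_w diag α)(ℂ)`), the TRANSPORTED family `t γ := t_T ∘ (Z(γ) = T)` and the Weil-form family `m` — generic in the group `G`.

* `continuous_subgroupCongr` — the identity isomorphism `H ≃* K` of equal subgroups is a homeomorphism (both directions).
* `isHaarMeasure_map_subgroupCongr` — it transports Haar measures.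
* **`exists_centralizerMeasures_eq_map_subgroupCongr`** — `∃ t, (∀ γ, P γ → t γ = t_T.map (T = Z(γ))) ∧ (∀ γ, P γ → IsHaarMeasure (t γ) ∧ IsInvInvariant (t γ))`
  (inversion invariance from commutativity of `Z(γ)`, ★ `isMulRightInvariant_of_forall_comm`).
* **`exists_isQuotientOf_of_torusHaar`** — `∃ t m, (transport clause) ∧ OrbitalMeasureFamily.IsQuotientOf P ν t m` (★ `OrbitalMeasureFamily.exists_isQuotientOf`).

JUNK AUDIT: off `P` the measures `t γ` are `0` (never read: `IsQuotientOf` and every consumer quantify `P γ →`); `hP` asks `T = Z(γ)` literally (as subgroups), `hcomm` the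
commutativity of `Z(γ)` at `P`-points (for a maximal torus both hold exactly at its regular points); no hypothesis relates `t_T` to `ν` — the VISIBLE mass `t_T(T)` is
print's normalisation datum (LEAD T6-61 (iii): a hypothesis, never a def-smuggled choice).
HONEST LABEL: HC_CM is proved only modulo the printed citations until rung 0 closes; this file is measure-theoretic plumbing (count-neutral).

## References
* J. D. Rogawski, *Automorphic Representations of Unitary Groups in Three Variables*, Ann. of Math. Stud. 123 (1990), §1.7 p. 6, §4.3 (4.3.1) p. 43, §8.2 p. 122 [Rogawski1990].
* A. Deitmar, S. Echterhoff, *Principles of Harmonic Analysis*, 2nd ed. (2014), Thm. 1.5.3 (invariant quotient measures) [DeitmarEchterhoff2014].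
* G. B. Folland, *A Course in Abstract Harmonic Analysis* (1995), Thm. 2.49 (abelian ⇒ unimodular) [Folland1995].
-/

set_option autoImplicit false

noncomputable section

open MeasureTheory Measure

namespace Literature.NumberTheory.Automorphic

/-! ## §1 Equal subgroups: the identity isomorphism is a homeomorphism and transports Haar measures -/

section Congr

variable {G : Type*} [Group G] [TopologicalSpace G]

/-- `MulEquiv.subgroupCongr h : H ≃* K` (equal subgroups) is continuous in both directions (it is the identity on the underlying elements).
[cite: DeitmarEchterhoff2014, Thm. 1.5.3] -/
theorem continuous_subgroupCongr {H K : Subgroup G} (h : H = K) :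
    Continuous (MulEquiv.subgroupCongr h) ∧ Continuous (MulEquiv.subgroupCongr h).symm := by
  subst h
  exact ⟨continuous_induced_rng.2 continuous_subtype_val, continuous_induced_rng.2 continuous_subtype_val⟩

/-- Transport of a Haar measure along `H = K`: `(μ.map (subgroupCongr h)).IsHaarMeasure`. [cite: DeitmarEchterhoff2014, Thm. 1.5.3] -/
theorem isHaarMeasure_map_subgroupCongr [IsTopologicalGroup G] [MeasurableSpace G] [BorelSpace G] {H K : Subgroup G} (h : H = K)
    (μ : Measure H) [μ.IsHaarMeasure] : (μ.map (MulEquiv.subgroupCongr h)).IsHaarMeasure := by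
  let e : H ≃ₜ* K :=
    { MulEquiv.subgroupCongr h with
      continuous_toFun := (continuous_subgroupCongr h).1
      continuous_invFun := (continuous_subgroupCongr h).2 }
  exact ContinuousMulEquiv.isHaarMeasure_map μ e

end Congr

/-! ## §2 The transported centraliser measures and the Weil-form family -/

section Torus

variable {G : Type*} [Group G] [TopologicalSpace G] [IsTopologicalGroup G] [LocallyCompactSpace G] [SecondCountableTopology G]
  [T2Space G] [MeasurableSpace G] [BorelSpace G]

/-- **TORUS-NORMALISED CENTRALISER MEASURES**: from ONE Haar measure `t_T` on a subgroup `T` and a predicate `P` with `T = Z(γ)` and `Z(γ)` commutative at every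
`P`-point, there is a family `t γ` of measures on the centralisers with `t γ = t_T.map (T = Z(γ))` at `P`-points, each an inversion-invariant Haar measure there (print's
«one Haar measure on the Cartan subgroup» normalisation of `Φ_γ`, `γ ∈ T_reg`). [cite: Rogawski1990, §1.7 p. 6; §4.3 (4.3.1) p. 43] [cite: Folland1995, Thm. 2.49] -/
theorem exists_centralizerMeasures_eq_map_subgroupCongr (T : Subgroup G) (tT : Measure T) [tT.IsHaarMeasure] (P : G → Prop)
    (hP : ∀ γ, P γ → T = Subgroup.centralizer ({γ} : Set G))
    (hcomm : ∀ γ, P γ → ∀ a ∈ Subgroup.centralizer ({γ} : Set G), ∀ b ∈ Subgroup.centralizer ({γ} : Set G), a * b = b * a) :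
    ∃ t : ∀ γ : G, Measure (Subgroup.centralizer ({γ} : Set G)),
      (∀ (γ : G) (h : P γ), t γ = tT.map (MulEquiv.subgroupCongr (hP γ h))) ∧
        ∀ γ, P γ → (t γ).IsHaarMeasure ∧ (t γ).IsInvInvariant := by
  classical
  refine ⟨fun γ => if h : P γ then tT.map (MulEquiv.subgroupCongr (hP γ h)) else 0, fun γ h => by simp only [dif_pos h], fun γ h => ?_⟩
  simp only [dif_pos h]
  haveI hH : (tT.map (MulEquiv.subgroupCongr (hP γ h))).IsHaarMeasure := isHaarMeasure_map_subgroupCongr (hP γ h) tT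
  haveI : (tT.map (MulEquiv.subgroupCongr (hP γ h))).IsMulRightInvariant :=
    isMulRightInvariant_of_forall_comm (Subgroup.centralizer ({γ} : Set G)) (isClosed_coe_centralizer_singleton γ) (hcomm γ h) _
  exact ⟨hH, Literature.MeasureTheory.Group.isInvInvariant_of_isMulRightInvariant_of_isClosed (Subgroup.centralizer ({γ} : Set G))
    (isClosed_coe_centralizer_singleton γ) _⟩

variable [∀ γ : G, MeasurableSpace (G ⧸ Subgroup.centralizer ({γ} : Set G))] [∀ γ : G, BorelSpace (G ⧸ Subgroup.centralizer ({γ} : Set G))]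

/-- **THE TORUS-NORMALISED WEIL-FORM FAMILY**: with `ν` a right-invariant measure on `G` (finite on compacts) and the data of the previous theorem, there are centraliser
measures `t` (= `t_T` transported at every `P`-point) and an orbital-measure family `m` with ★ `OrbitalMeasureFamily.IsQuotientOf P ν t m` — `m c = dν ∕ dt_T` on the class
of every `P`-point: the normalisation under which `γ ↦ Φ_γ(f)` is Harish-Chandra's function on `T_reg`. [cite: Rogawski1990, §1.7 p. 6; §4.3 (4.3.1) p. 43; §8.2 p. 122]
[cite: DeitmarEchterhoff2014, Thm. 1.5.3] -/
theorem exists_isQuotientOf_of_torusHaar (ν : Measure G) [IsFiniteMeasureOnCompacts ν] [ν.IsMulRightInvariant]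
    (T : Subgroup G) (tT : Measure T) [tT.IsHaarMeasure] (P : G → Prop)
    (hP : ∀ γ, P γ → T = Subgroup.centralizer ({γ} : Set G))
    (hcomm : ∀ γ, P γ → ∀ a ∈ Subgroup.centralizer ({γ} : Set G), ∀ b ∈ Subgroup.centralizer ({γ} : Set G), a * b = b * a) :
    ∃ (t : ∀ γ : G, Measure (Subgroup.centralizer ({γ} : Set G))) (m : OrbitalMeasureFamily G),
      (∀ (γ : G) (h : P γ), t γ = tT.map (MulEquiv.subgroupCongr (hP γ h))) ∧ m.IsQuotientOf P ν t := by
  obtain ⟨t, ht, hinv⟩ := exists_centralizerMeasures_eq_map_subgroupCongr T tT P hP hcomm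
  obtain ⟨m, hm⟩ := OrbitalMeasureFamily.exists_isQuotientOf P ν t hinv
  exact ⟨t, m, ht, hm⟩

end Torus

end Literature.NumberTheory.Automorphic

end
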